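import Mathlib.Analysis.Calculus.ParametricIntegral
import Literature.Geometry.Riemannian.RicciFlowVolumeDeriv
import HarnessLib

/-!
# Differentiating an integral against the evolving volume of a Ricci flow:
# `d/dt ∫_M F(t, ·) dV_{g(t)} = ∫_M (∂ₜF − R F)(t, ·) dV_{g(t)}` (Topping 2006, §6.3)

Topping, *Lectures on the Ricci flow* (2006), proof of Prop. 6.3.1 (p. 57): "Keeping in mind
(2.5.7) [`∂ₜ dV = −R dV`] we may calculate `d/dt ∫ v w dV = ∫ (∂ₜv · w + v · ∂ₜw − R v w) dV`";
and Rem. 6.3.2, (6.3.2): `d/dt ∫ w dV = −∫ □* w dV`, `□* = −∂ₜ − Δ + R`. The common content is the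
Leibniz rule for a time-dependent integrand against the time-dependent Riemannian measure of a
Ricci flow, which this file PROVES in the tree's rendering of the volume
(`PseudoRiemannianMetric.riemVolume`, the Euclidean-normalised Hausdorff measure of the length
distance; `dV_{g(t)} = e^{−∫_{t₀}^t R} dV_{g(t₀)}`, `IsRicciFlow.riemVolume_eq_withDensity`,
`RicciFlowVolumeDensity.lean`), extending `RicciFlowVolumeDeriv.lean` (the case `F = 1_A`):

* `IsRicciFlow.hasDerivAt_integral_riemVolume` — for a Ricci flow of Riemannian metrics on a
  closed manifold modelled on `ℝ^m`, on a convex time set `S`, and `F, ∂ₜF` jointly continuous on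
  `M × S` with `∂ₜF` the time derivative of `F` within `S`: at every interior time `t₀`,
  `d/dt|_{t₀} ∫_M F(t, p) dV_{g(t)}(p) = ∫_M (∂ₜF(t₀, p) − R(p, t₀) F(t₀, p)) dV_{g(t₀)}(p)`;
* `IsRicciFlow.hasDerivWithinAt_integral_riemVolume` — the same derivative **within `S` at every
  `t₀ ∈ S`**, one-sided at endpoints (limits of the interior derivatives, which are continuous in
  `t` by `IsRicciFlow.continuousOn_integral_mul_exp`);
* `IsRicciFlow.integral_riemVolume_eq_of_hasDerivWithinAt_zero` — if moreover
  `∫_M (∂ₜF − R F)(t, ·) dV_{g(t)} = 0` for all `t ∈ S`, then `t ↦ ∫_M F(t, ·) dV_{g(t)}` is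
  constant on `S` (the form in which (6.3.2) gives the conservation of `∫ u dV` along the
  conjugate heat flow, Topping Rem. 8.2.2).

Proof: `∫ F(t, ·) dV_{g(t)} = ∫ F(t, p) e^{−∫_{t₀}^t R(p, τ) dτ} dV_{g(t₀)}(p)`
(`IsRicciFlow.integral_riemVolume_eq`), and one differentiates under the integral sign against
the fixed finite measure `dV_{g(t₀)}` (Mathlib's `hasDerivAt_integral_of_dominated_loc_of_deriv_le`),
the `t`-derivative `(∂ₜF − R F) e^{−∫_{t₀}^t R}` being bounded on `M × [t₀ − ε, t₀ + ε]` by the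
joint continuity of `F`, `∂ₜF` and `R` (`IsRicciFlow.continuousOn_scalarCurvatureWith_prod`).
Everything is proved; there are no definitions and no named facts.

## References

* P. Topping, *Lectures on the Ricci flow*, LMS Lecture Note Series 325, Cambridge Univ. Press
  2006, §2.5, (2.5.7) (p. 33); §6.3, Prop. 6.3.1 (proof) and Rem. 6.3.2, (6.3.2) (p. 57);
  §8.2, Rem. 8.2.2. [Topping2006]
* G. Perelman, *The entropy formula for the Ricci flow and its geometric applications*,
  arXiv:math/0211159 (2002), §3.1 (the conjugate heat operator `□*`). [Perelman2002]
-/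

noncomputable section

open Set Module MeasureTheory Function Bundle Filter intervalIntegral Metric
open scoped Manifold ContDiff Topology ENNReal

namespace Literature.Geometry.Riemannian

open Lorentzian Lorentzian.PseudoRiemannianMetric

universe v w

section Deriv

variable {m : ℕ} {H : Type v} [TopologicalSpace H]
  {I : ModelWithCorners ℝ (EuclideanSpace ℝ (Fin m)) H} [I.Boundaryless]
  {M : Type w} [TopologicalSpace M] [ChartedSpace H M] [IsManifold I ∞ M]
  [T2Space M] [CompactSpace M] [MeasurableSpace M] [BorelSpace M]
  {g : ℝ → PseudoRiemannianMetric I ∞ (EuclideanSpace ℝ (Fin m)) (TangentSpace I : M → Type _)}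
  {cov : ℝ → CovariantDerivative I (EuclideanSpace ℝ (Fin m)) (TangentSpace I : M → Type _)}
  {S : Set ℝ}

omit [I.Boundaryless] [IsManifold I ∞ M] [T2Space M] [CompactSpace M] [MeasurableSpace M]
  [BorelSpace M] in
/-- A function jointly continuous on `M × S` has continuous slices `p ↦ F(t, p)`, `t ∈ S`.
[folklore] -/
theorem continuous_slice_of_continuousOn_prod {F : ℝ → M → ℝ}
    (hF : ContinuousOn (fun z : M × ℝ ↦ F z.2 z.1) (univ ×ˢ S)) {t : ℝ} (ht : t ∈ S) :
    Continuous fun p : M ↦ F t p :=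
  (hF.comp_continuous (continuous_id.prodMk continuous_const) fun _ ↦ ⟨mem_univ _, ht⟩ :)

omit [I.Boundaryless] [IsManifold I ∞ M] [T2Space M] [MeasurableSpace M] [BorelSpace M] in
/-- A function jointly continuous on `M × S`, `M` compact, is bounded on `M × K` for every compact
`K ⊆ S`, by a nonnegative constant. [folklore] -/
theorem exists_forall_abs_le_of_continuousOn_prod {F : ℝ → M → ℝ}
    (hF : ContinuousOn (fun z : M × ℝ ↦ F z.2 z.1) (univ ×ˢ S)) {K : Set ℝ} (hK : IsCompact K)
    (hKS : K ⊆ S) : ∃ C : ℝ, 0 ≤ C ∧ ∀ t ∈ K, ∀ p : M, |F t p| ≤ C := by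
  obtain ⟨C, hC⟩ := (isCompact_univ.prod hK).exists_bound_of_continuousOn
    (hF.mono (prod_mono le_rfl hKS))
  exact ⟨max C 0, le_max_right _ _, fun t ht p ↦
    (Real.norm_eq_abs _ ▸ hC (p, t) ⟨mem_univ _, ht⟩).trans (le_max_left _ _)⟩

/-- **`d/dt ∫_M F(t, ·) dV_{g(t)} = ∫_M (∂ₜF − R F) dV_{g(t)}` at interior times** (Topping 2006,
proof of Prop. 6.3.1: "Keeping in mind (2.5.7) we may calculate
`d/dt ∫ vw dV = ∫ (∂ₜv w + v ∂ₜw − R v w) dV`", here for one integrand `F = vw`). For a Ricci flow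
of Riemannian metrics on a closed manifold modelled on `ℝ^m`, on a convex time set `S`, let
`F, F' : S × M → ℝ` be jointly continuous on `M × S` with `∂ₜF(t, p) = F'(t, p)` as a derivative
within `S` at every `t ∈ S`. Then at every interior time `t₀` of `S` the function
`t ↦ ∫_M F(t, p) dV_{g(t)}(p)` has derivative `∫_M (F'(t₀, p) − R(p, t₀) F(t₀, p)) dV_{g(t₀)}(p)`.
Proof: near `t₀`, `∫ F(t, ·) dV_{g(t)} = ∫ F(t, p) e^{−∫_{t₀}^t R(p, τ) dτ} dV_{g(t₀)}`
(`integral_riemVolume_eq`), and one differentiates under the integral sign, the `t`-derivative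
`(F' − R F) e^{−∫_{t₀}^t R}` being bounded on `M × [t₀ − ε, t₀ + ε]`.
[cite: Topping2006, §6.3, proof of Prop. 6.3.1 (p. 57) and (2.5.7) (p. 33)] -/
theorem IsRicciFlow.hasDerivAt_integral_riemVolume (h : IsRicciFlow g cov S) (hS : Convex ℝ S)
    (hR : ∀ t ∈ S, (g t).IsRiemannian) {F F' : ℝ → M → ℝ}
    (hF : ContinuousOn (fun z : M × ℝ ↦ F z.2 z.1) (univ ×ˢ S))
    (hF' : ContinuousOn (fun z : M × ℝ ↦ F' z.2 z.1) (univ ×ˢ S))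
    (hd : ∀ p : M, ∀ t ∈ S, HasDerivWithinAt (F · p) (F' t p) S t)
    {t₀ : ℝ} (ht₀ : t₀ ∈ interior S) :
    HasDerivAt (fun t ↦ ∫ p, F t p ∂(g t).riemVolume)
      (∫ p, (F' t₀ p - (g t₀).scalarCurvatureWith (cov t₀) p * F t₀ p) ∂(g t₀).riemVolume) t₀ := by
  have hU : UniqueDiffOn ℝ S := uniqueDiffOn_convex hS ⟨t₀, ht₀⟩
  have ht₀S : t₀ ∈ S := interior_subset ht₀
  -- an interval `[t₀ - ε, t₀ + ε]` inside the interior of `S`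
  obtain ⟨ε, hε, hεS⟩ : ∃ ε > 0, closedBall t₀ ε ⊆ interior S :=
    nhds_basis_closedBall.mem_iff.1 (isOpen_interior.mem_nhds ht₀)
  set a : ℝ := t₀ - ε with ha
  set b : ℝ := t₀ + ε with hb
  have hIcc : Icc a b ⊆ interior S := fun t ht ↦ hεS (by
    rw [mem_closedBall, Real.dist_eq, abs_le]; constructor <;> linarith [ht.1, ht.2])
  have hIccS : Icc a b ⊆ S := hIcc.trans interior_subset
  have ht₀ab : t₀ ∈ Icc a b := ⟨by linarith, by linarith⟩
  -- notation
  set Rf : ℝ → M → ℝ := fun t p ↦ (g t).scalarCurvatureWith (cov t) p with hRf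
  set Φ : ℝ → M → ℝ := fun t p ↦ Real.exp (-∫ τ in t₀..t, Rf τ p) with hΦ
  set G : ℝ → M → ℝ := fun t p ↦ F t p * Φ t p with hG
  set G' : ℝ → M → ℝ := fun t p ↦ (F' t p - Rf t p * F t p) * Φ t p with hG'
  set μ : Measure M := (g t₀).riemVolume with hμ
  haveI : IsFiniteMeasure μ := ⟨(g t₀).riemVolume_univ_lt_top⟩
  -- continuity of `R`, `F`, `F'`: jointly, in time, in space
  have hjoint : ContinuousOn (fun z : M × ℝ ↦ Rf z.2 z.1) (univ ×ˢ S) :=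
    h.continuousOn_scalarCurvatureWith_prod hU
  have hRt : ∀ p : M, ContinuousOn (fun τ ↦ Rf τ p) S := fun p ↦
    h.continuousOn_scalarCurvatureWith hU p
  have hRx : ∀ t ∈ S, Continuous fun p : M ↦ Rf t p := fun t ht ↦
    continuous_slice_of_continuousOn_prod hjoint ht
  have hFx : ∀ t ∈ S, Continuous fun p : M ↦ F t p := fun t ht ↦
    continuous_slice_of_continuousOn_prod hF ht
  have hF'x : ∀ t ∈ S, Continuous fun p : M ↦ F' t p := fun t ht ↦
    continuous_slice_of_continuousOn_prod hF' ht
  have hΦx : ∀ t ∈ S, Continuous fun p : M ↦ Φ t p := fun t ht ↦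
    h.continuous_exp_neg_integral_scalarCurvature hS ht₀S ht
  -- uniform bounds for `|R|`, `|F|`, `|F'|` on `M × [a, b]`
  obtain ⟨C₀, hC₀, hC₀'⟩ := exists_forall_abs_le_of_continuousOn_prod hjoint isCompact_Icc hIccS
  obtain ⟨D₀, hD₀, hD₀'⟩ := exists_forall_abs_le_of_continuousOn_prod hF isCompact_Icc hIccS
  obtain ⟨D₁, hD₁, hD₁'⟩ := exists_forall_abs_le_of_continuousOn_prod hF' isCompact_Icc hIccS
  -- the `t`-derivative of the density and of the integrand
  have hΦd : ∀ (p : M), ∀ t ∈ Icc a b, HasDerivAt (Φ · p) (-(Rf t p) * Φ t p) t := by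
    intro p t ht
    have htS : S ∈ 𝓝 t := mem_interior_iff_mem_nhds.1 (hIcc ht)
    have hsub : uIcc t₀ t ⊆ S := (ordConnected_Icc.uIcc_subset ht₀ab ht).trans hIccS
    have h1 : HasDerivAt (fun t ↦ ∫ τ in t₀..t, Rf τ p) (Rf t p) t :=
      integral_hasDerivAt_right ((hRt p).mono hsub).intervalIntegrable
        (ContinuousOn.stronglyMeasurableAtFilter isOpen_interior
          ((hRt p).mono interior_subset) t (hIcc ht))
        ((hRt p).continuousAt htS)
    have h1' : HasDerivAt (fun t ↦ -∫ τ in t₀..t, Rf τ p) (-Rf t p) t := h1.neg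
    refine h1'.exp.congr_deriv ?_
    simp only [hΦ]
    ring
  have hderiv : ∀ (p : M), ∀ t ∈ Icc a b, HasDerivAt (G · p) (G' t p) t := by
    intro p t ht
    have htS : S ∈ 𝓝 t := mem_interior_iff_mem_nhds.1 (hIcc ht)
    have hFd : HasDerivAt (F · p) (F' t p) t := (hd p t (hIccS ht)).hasDerivAt htS
    refine (hFd.mul (hΦd p t ht)).congr_deriv ?_
    simp only [hG']
    ring
  -- the bound on the derivative
  have hbound : ∀ (p : M), ∀ t ∈ Icc a b, ‖G' t p‖ ≤ (D₁ + C₀ * D₀) * Real.exp (C₀ * ε) := by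
    intro p t ht
    have hsubab : uIcc t₀ t ⊆ Icc a b := ordConnected_Icc.uIcc_subset ht₀ab ht
    have hint : ‖∫ τ in t₀..t, Rf τ p‖ ≤ C₀ * ε := by
      have h1 : ‖∫ τ in t₀..t, Rf τ p‖ ≤ C₀ * |t - t₀| :=
        intervalIntegral.norm_integral_le_of_norm_le_const fun τ hτ ↦
          (Real.norm_eq_abs _).le.trans
            (hC₀' τ (hsubab (uIoc_subset_uIcc hτ)) p)
      have h2 : |t - t₀| ≤ ε := by
        rw [abs_le]; constructor <;> linarith [ht.1, ht.2]
      exact h1.trans (mul_le_mul_of_nonneg_left h2 hC₀)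
    have hΦle : Φ t p ≤ Real.exp (C₀ * ε) := by
      simp only [hΦ]
      refine Real.exp_le_exp.2 ?_
      have := neg_le_abs (∫ τ in t₀..t, Rf τ p)
      rw [← Real.norm_eq_abs] at this
      linarith
    have hΦpos : 0 < Φ t p := Real.exp_pos _
    have hcoef : |F' t p - Rf t p * F t p| ≤ D₁ + C₀ * D₀ := by
      calc |F' t p - Rf t p * F t p| ≤ |F' t p| + |Rf t p * F t p| := abs_sub _ _
        _ = |F' t p| + |Rf t p| * |F t p| := by rw [abs_mul]
        _ ≤ D₁ + C₀ * D₀ := add_le_add (hD₁' t ht p)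
            (mul_le_mul (hC₀' t ht p) (hD₀' t ht p) (abs_nonneg _) hC₀)
    calc ‖G' t p‖ = |F' t p - Rf t p * F t p| * Φ t p := by
          simp only [hG', norm_mul, Real.norm_eq_abs, abs_of_pos hΦpos]
      _ ≤ (D₁ + C₀ * D₀) * Real.exp (C₀ * ε) :=
          mul_le_mul hcoef hΦle hΦpos.le (by positivity)
  -- integrability of `G(t₀) = F(t₀)` (bounded and continuous on a finite measure space)
  have hGt₀ : G t₀ = F t₀ := by
    funext p; simp [hG, hΦ]
  have hint₀ : Integrable (G t₀) μ := by
    rw [hGt₀]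
    refine (integrable_const D₀).mono' (hFx t₀ ht₀S).aestronglyMeasurable
      (Filter.Eventually.of_forall fun p ↦ ?_)
    rw [Real.norm_eq_abs]
    exact hD₀' t₀ ht₀ab p
  -- differentiation under the integral sign
  have hmain := hasDerivAt_integral_of_dominated_loc_of_deriv_le (μ := μ) (F := G) (F' := G')
    (x₀ := t₀) (s := Icc a b) (bound := fun _ ↦ (D₁ + C₀ * D₀) * Real.exp (C₀ * ε))
    (Icc_mem_nhds (by linarith) (by linarith))
    (Filter.eventually_of_mem (isOpen_interior.mem_nhds ht₀) fun t ht ↦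
      ((hFx t (interior_subset ht)).mul (hΦx t (interior_subset ht))).aestronglyMeasurable)
    hint₀
    ((((hF'x t₀ ht₀S).sub ((hRx t₀ ht₀S).mul (hFx t₀ ht₀S))).mul
      (hΦx t₀ ht₀S)).aestronglyMeasurable)
    (Filter.Eventually.of_forall fun p t ht ↦ hbound p t ht)
    (integrable_const _)
    (Filter.Eventually.of_forall fun p t ht ↦ hderiv p t ht)
  -- the value of the derivative: `∫ G'(t₀) = ∫ (F' - R F)(t₀) dV_{t₀}`
  have hval : ∫ p, G' t₀ p ∂μ = ∫ p, (F' t₀ p - Rf t₀ p * F t₀ p) ∂(g t₀).riemVolume := by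
    rw [hμ]
    refine integral_congr_ae (Filter.Eventually.of_forall fun p ↦ ?_)
    simp [hG', hΦ]
  -- the integral as the parametric integral, near `t₀`
  have hfun : (fun t ↦ ∫ p, F t p ∂(g t).riemVolume) =ᶠ[𝓝 t₀] fun t ↦ ∫ p, G t p ∂μ := by
    refine Filter.eventually_of_mem (isOpen_interior.mem_nhds ht₀) fun t ht ↦ ?_
    have htS : t ∈ S := interior_subset ht
    show ∫ p, F t p ∂(g t).riemVolume = ∫ p, G t p ∂μ
    rw [h.integral_riemVolume_eq hS hR ht₀S htS (F t), hμ]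
    exact integral_congr_ae (Filter.Eventually.of_forall fun p ↦ mul_comm _ _)
  rw [← hval]
  exact hmain.2.congr_of_eventuallyEq hfun

/-- **`d/dt ∫_M F(t, ·) dV_{g(t)} = ∫_M (∂ₜF − R F) dV_{g(t)}` within the time set, at every time**
(Topping 2006, proof of Prop. 6.3.1 with (2.5.7), including one-sided derivatives at the
endpoints of `S`): under the hypotheses of `hasDerivAt_integral_riemVolume`, for every `t₀ ∈ S` the
function `t ↦ ∫_M F(t, ·) dV_{g(t)}` has derivative `∫_M (F'(t₀, ·) − R(·, t₀) F(t₀, ·)) dV_{g(t₀)}`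
at `t₀` within `S`. At interior times this is `hasDerivAt_integral_riemVolume`; at an endpoint the
one-sided derivative is the limit of the interior derivatives
`∫ (F' − R F)(t, ·) dV_{g(t)} = ∫ (F' − R F)(t, p) e^{−∫_{t₀}^t R} dV_{g(t₀)}`, continuous in `t`
(`continuousOn_integral_mul_exp`), by Mathlib's `hasDerivWithinAt_Ici_of_tendsto_deriv` /
`hasDerivWithinAt_Iic_of_tendsto_deriv`.
[cite: Topping2006, §6.3, proof of Prop. 6.3.1 (p. 57) and (2.5.7) (p. 33)] -/
theorem IsRicciFlow.hasDerivWithinAt_integral_riemVolume (h : IsRicciFlow g cov S)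
    (hS : Convex ℝ S) (hR : ∀ t ∈ S, (g t).IsRiemannian) {F F' : ℝ → M → ℝ}
    (hF : ContinuousOn (fun z : M × ℝ ↦ F z.2 z.1) (univ ×ˢ S))
    (hF' : ContinuousOn (fun z : M × ℝ ↦ F' z.2 z.1) (univ ×ˢ S))
    (hd : ∀ p : M, ∀ t ∈ S, HasDerivWithinAt (F · p) (F' t p) S t)
    {t₀ : ℝ} (ht₀ : t₀ ∈ S) :
    HasDerivWithinAt (fun t ↦ ∫ p, F t p ∂(g t).riemVolume)
      (∫ p, (F' t₀ p - (g t₀).scalarCurvatureWith (cov t₀) p * F t₀ p) ∂(g t₀).riemVolume)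
      S t₀ := by
  set Rf : ℝ → M → ℝ := fun t p ↦ (g t).scalarCurvatureWith (cov t) p with hRf
  set V : ℝ → ℝ := fun t ↦ ∫ p, F t p ∂(g t).riemVolume with hV
  set L : ℝ := ∫ p, (F' t₀ p - Rf t₀ p * F t₀ p) ∂(g t₀).riemVolume with hL
  set μ : Measure M := (g t₀).riemVolume with hμ
  haveI : IsFiniteMeasure μ := ⟨(g t₀).riemVolume_univ_lt_top⟩
  -- `V(t) = ∫ F(t) e^{-∫ R} dV_{t₀}` and `∫ (F' - R F)(t) dV_t = ∫ (F' - R F)(t) e^{-∫ R} dV_{t₀}`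
  have hVeq : ∀ t ∈ S, V t = ∫ p, F t p * Real.exp (-∫ τ in t₀..t, Rf τ p) ∂μ := by
    intro t ht
    simp only [hV, hμ]
    rw [h.integral_riemVolume_eq hS hR ht₀ ht (F t)]
    exact integral_congr_ae (Filter.Eventually.of_forall fun p ↦ mul_comm _ _)
  have hDeq : ∀ t ∈ S, ∫ p, (F' t p - Rf t p * F t p) ∂(g t).riemVolume =
      ∫ p, (F' t p - Rf t p * F t p) * Real.exp (-∫ τ in t₀..t, Rf τ p) ∂μ := by
    intro t ht
    rw [h.integral_riemVolume_eq hS hR ht₀ ht, hμ]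
    exact integral_congr_ae (Filter.Eventually.of_forall fun p ↦ mul_comm _ _)
  have hL' : L = ∫ p, (F' t₀ p - Rf t₀ p * F t₀ p) * Real.exp (-∫ τ in t₀..t₀, Rf τ p) ∂μ :=
    hDeq t₀ ht₀
  -- one side at a time
  have key : ∀ (t₁ : ℝ), t₁ ∈ S → t₁ ≠ t₀ →
      ContinuousWithinAt V (Ioo (min t₀ t₁) (max t₀ t₁)) t₀ ∧
      DifferentiableOn ℝ V (Ioo (min t₀ t₁) (max t₀ t₁)) ∧
      Tendsto (fun t ↦ deriv V t) (𝓝[Ioo (min t₀ t₁) (max t₀ t₁)] t₀) (𝓝 L) := by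
    intro t₁ ht₁ hne
    have hU : UniqueDiffOn ℝ S := uniqueDiffOn_of_convex_of_ne hS ht₀ ht₁ hne.symm
    have hK : uIcc t₀ t₁ ⊆ S := hS.ordConnected.uIcc_subset ht₀ ht₁
    have hIoo : Ioo (min t₀ t₁) (max t₀ t₁) ⊆ interior S :=
      interior_maximal (Ioo_subset_Icc_self.trans hK) isOpen_Ioo
    have hIooS : Ioo (min t₀ t₁) (max t₀ t₁) ⊆ S := hIoo.trans interior_subset
    have ht₀K : t₀ ∈ uIcc t₀ t₁ := left_mem_uIcc
    -- continuity of `V` at `t₀` within the interval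
    have hW := h.continuousOn_integral_mul_exp hS ht₀ ht₁ ht₀K μ (Θ := F) hF
    have hcont : ContinuousWithinAt V (Ioo (min t₀ t₁) (max t₀ t₁)) t₀ := by
      have h1 : ContinuousWithinAt (fun t ↦ ∫ p, F t p * Real.exp (-∫ τ in t₀..t, Rf τ p) ∂μ)
          (Ioo (min t₀ t₁) (max t₀ t₁)) t₀ := (hW t₀ ht₀K).mono Ioo_subset_Icc_self
      exact h1.congr (fun t ht ↦ hVeq t (hIooS ht)) (hVeq t₀ ht₀)
    -- differentiability inside
    have hdiff : DifferentiableOn ℝ V (Ioo (min t₀ t₁) (max t₀ t₁)) := fun t ht ↦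
      (h.hasDerivAt_integral_riemVolume hS hR hF hF' hd (hIoo ht)).differentiableAt.differentiableWithinAt
    -- the limit of the derivatives
    have hjoint : ContinuousOn (fun z : M × ℝ ↦ Rf z.2 z.1) (univ ×ˢ S) :=
      h.continuousOn_scalarCurvatureWith_prod hU
    have hΘ : ContinuousOn (fun z : M × ℝ ↦ F' z.2 z.1 - Rf z.2 z.1 * F z.2 z.1) (univ ×ˢ S) :=
      hF'.sub (hjoint.mul hF)
    have hWR := h.continuousOn_integral_mul_exp hS ht₀ ht₁ ht₀K μ
      (Θ := fun t p ↦ F' t p - Rf t p * F t p) hΘ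
    have hlim : Tendsto (fun t ↦ deriv V t) (𝓝[Ioo (min t₀ t₁) (max t₀ t₁)] t₀) (𝓝 L) := by
      have h1 : Tendsto (fun t ↦ ∫ p, (F' t p - Rf t p * F t p) *
          Real.exp (-∫ τ in t₀..t, Rf τ p) ∂μ) (𝓝[Ioo (min t₀ t₁) (max t₀ t₁)] t₀) (𝓝 L) := by
        rw [hL']
        exact ((hWR t₀ ht₀K).mono Ioo_subset_Icc_self).tendsto
      refine h1.congr' ?_
      filter_upwards [self_mem_nhdsWithin] with t ht
      rw [(h.hasDerivAt_integral_riemVolume hS hR hF hF' hd (hIoo ht)).deriv, hDeq t (hIooS ht)]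
    exact ⟨hcont, hdiff, hlim⟩
  -- right derivative
  have hright : HasDerivWithinAt V L (S ∩ Ici t₀) t₀ := by
    by_cases hex : ∃ t₁ ∈ S, t₀ < t₁
    · obtain ⟨t₁, ht₁, hlt⟩ := hex
      obtain ⟨hcont, hdiff, hlim⟩ := key t₁ ht₁ hlt.ne'
      rw [min_eq_left hlt.le, max_eq_right hlt.le] at hcont hdiff hlim
      have hmem : Ioo t₀ t₁ ∈ 𝓝[>] t₀ := Ioo_mem_nhdsGT hlt
      have hle : 𝓝[>] t₀ ≤ 𝓝[Ioo t₀ t₁] t₀ := nhdsWithin_le_of_mem hmem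
      exact (hasDerivWithinAt_Ici_of_tendsto_deriv hdiff hcont hmem (hlim.mono_left hle)).mono
        inter_subset_right
    · simp only [not_exists, not_and, not_lt] at hex
      refine hasDerivWithinAt_iff_tendsto_slope.2 ?_
      have hempty : (S ∩ Ici t₀) \ {t₀} = ∅ := by
        refine eq_empty_iff_forall_notMem.2 ?_
        rintro t ⟨⟨htS, hle⟩, hne⟩
        exact hne (mem_singleton_iff.2 (le_antisymm (hex t htS) hle))
      rw [hempty, nhdsWithin_empty]
      exact tendsto_bot
  -- left derivative
  have hleft : HasDerivWithinAt V L (S ∩ Iic t₀) t₀ := by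
    by_cases hex : ∃ t₁ ∈ S, t₁ < t₀
    · obtain ⟨t₁, ht₁, hlt⟩ := hex
      obtain ⟨hcont, hdiff, hlim⟩ := key t₁ ht₁ hlt.ne
      rw [min_eq_right hlt.le, max_eq_left hlt.le] at hcont hdiff hlim
      have hmem : Ioo t₁ t₀ ∈ 𝓝[<] t₀ := Ioo_mem_nhdsLT hlt
      have hle : 𝓝[<] t₀ ≤ 𝓝[Ioo t₁ t₀] t₀ := nhdsWithin_le_of_mem hmem
      exact (hasDerivWithinAt_Iic_of_tendsto_deriv hdiff hcont hmem (hlim.mono_left hle)).mono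
        inter_subset_right
    · simp only [not_exists, not_and, not_lt] at hex
      refine hasDerivWithinAt_iff_tendsto_slope.2 ?_
      have hempty : (S ∩ Iic t₀) \ {t₀} = ∅ := by
        refine eq_empty_iff_forall_notMem.2 ?_
        rintro t ⟨⟨htS, hle⟩, hne⟩
        exact hne (mem_singleton_iff.2 (le_antisymm hle (hex t htS)))
      rw [hempty, nhdsWithin_empty]
      exact tendsto_bot
  have hSU : S = (S ∩ Ici t₀) ∪ (S ∩ Iic t₀) := by
    ext t
    simp only [mem_union, mem_inter_iff, mem_Ici, mem_Iic]
    constructor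
    · intro ht; rcases le_total t₀ t with h' | h' <;> [exact Or.inl ⟨ht, h'⟩; exact Or.inr ⟨ht, h'⟩]
    · rintro (⟨ht, -⟩ | ⟨ht, -⟩) <;> exact ht
  rw [hSU]
  exact hright.union hleft

/-- **Conservation**: if, in the setting of `hasDerivWithinAt_integral_riemVolume`,
`∫_M (F'(t, ·) − R(·, t) F(t, ·)) dV_{g(t)} = 0` for every `t ∈ S`, then `∫_M F(t, ·) dV_{g(t)}`
does not depend on `t ∈ S` (a function on a convex set of times whose derivative within the set
vanishes everywhere is constant). This is the form of Topping's (6.3.2),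
`d/dt ∫ w dV = −∫ □* w dV`, used in Rem. 8.2.2: "the compatibility constraint is preserved …
`d/dt ∫ u dV = −∫ □* u dV = 0`". [cite: Topping2006, §6.3, Rem. 6.3.2, (6.3.2) (p. 57); §8.2, Rem. 8.2.2] -/
theorem IsRicciFlow.integral_riemVolume_eq_of_integral_eq_zero (h : IsRicciFlow g cov S)
    (hS : Convex ℝ S) (hR : ∀ t ∈ S, (g t).IsRiemannian) {F F' : ℝ → M → ℝ}
    (hF : ContinuousOn (fun z : M × ℝ ↦ F z.2 z.1) (univ ×ˢ S))
    (hF' : ContinuousOn (fun z : M × ℝ ↦ F' z.2 z.1) (univ ×ˢ S))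
    (hd : ∀ p : M, ∀ t ∈ S, HasDerivWithinAt (F · p) (F' t p) S t)
    (h0 : ∀ t ∈ S,
      ∫ p, (F' t p - (g t).scalarCurvatureWith (cov t) p * F t p) ∂(g t).riemVolume = 0)
    {s t : ℝ} (hs : s ∈ S) (ht : t ∈ S) :
    ∫ p, F t p ∂(g t).riemVolume = ∫ p, F s p ∂(g s).riemVolume := by
  rcases eq_or_ne s t with rfl | hst
  · rfl
  have hU : UniqueDiffOn ℝ S := uniqueDiffOn_of_convex_of_ne hS hs ht hst
  have hD : ∀ τ ∈ S, HasDerivWithinAt (fun t ↦ ∫ p, F t p ∂(g t).riemVolume) 0 S τ := by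
    intro τ hτ
    have := h.hasDerivWithinAt_integral_riemVolume hS hR hF hF' hd hτ
    rwa [h0 τ hτ] at this
  have hdiff : DifferentiableOn ℝ (fun t ↦ ∫ p, F t p ∂(g t).riemVolume) S := fun τ hτ ↦
    (hD τ hτ).differentiableWithinAt
  exact hS.is_const_of_fderivWithin_eq_zero hdiff
    (fun τ hτ ↦ by rw [(hD τ hτ).hasFDerivWithinAt.fderivWithin (hU τ hτ)]; simp) ht hs

end Deriv

end Literature.Geometry.Riemannian

end
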